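/-
Copyright (c) 2026. All rights reserved.
Released under Apache 2.0 license as described in the file LICENSE.
Authors: abc-iut cell, wave-4 seat abc-iut-w4-d085 (proof-only; the (AI4″) producer of abc-iut-w4-d059
WITHOUT the arithmetic cofinality binder `hcof`: the joint level kernel of the compact completion is
absorbed into the vertex group instead of being assumed trivial).
-/
import Literature.AnabelianGeometry.SemiGraphs.ArithBranchPairAug
import HarnessLib

/-!
# [SemiAnbd] Thm 5.4 (i) p. 66: the (AI4″) branch-pair conclusion WITHOUT arithmetic cofinality
# (`hcof` replaced by the weaker «`U_∞` is realised inside `Π_{v₀}`»)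

Mochizuki, *Semi-graphs of anabelioids*, Publ. RIMS **42** (2006), proof of Thm 3.7 (iii) p. 41 ("[cf.
Remark 2.2.1] … contained in some conjugate in the profinite fundamental group"), Thm 5.4 (i) p. 66
("entirely parallel", arithmetic translation), Def 5.1 (i) p. 62 (`ρ_𝒢 : π̂₁(A) → Aut(𝒢)` an arbitrary
homomorphism with continuity (a)–(d)). [cite: MochizukiSemiAnbd2006, Thm 5.4 (i) p.66]

PROOF-ONLY file (abc-iut cell, producer row T54-B of `plan/GAP-LEDGER.md` G-w4d053-1, gap row
G-w4d085-1; seat abc-iut-w4-d085 gen 4).  abc-iut-w4-d059's `map_aug_le_conj_of_levelDict′`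
(ArithBranchPairAug.lean, p433546) produces the field `stabBranchPairAug` of `ArithLevelDataCpt` from
E-level inputs plus the COFINALITY binder `hcof : ∀ U ∈ 𝓝 1, ∃ j, aug (ker levelAct j) ⊆ U`, used exactly
once: to make the joint kernel `⋂ⱼ ker qAct j` of abc-iut-w4-d029's compact completion `Q` TRIVIAL
(`iInf_ker_qAct_eq_bot`), so that the `Q`-stabiliser of the reference pro-vertex is `ιQ(Π_{v₀})`.  At the
outer model `π₁^temp(𝒢) ⋊^out Π_A`, `hcof` is equivalent to «hfaith-arith» and FORCES the joint action of
`Π_A` on `𝒢` to be faithful (`ker_inf_ker_eq_bot_of_hcof_outerAction`, ArithLevelCofinalityOuterAction.lean)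
— a hypothesis print's Def 5.1 (i) does not make.  Here `hcof` is REMOVED: the joint kernel need not be
trivial, it only has to lie INSIDE `ιQ(Π_{v₀})`, and that follows from the weaker, print-compatible binder

  `hU : ∀ a, (∀ j, a ∈ aug (ker levelAct j)) → ∃ z ∈ Π_{v₀}, aug z = a ∧ ∀ j, levelAct j z = 1`

("every element of `U_∞ := ⋂ⱼ aug (ker levelAct j)` is realised by an element of the vertex group acting
trivially at every level"; at the outer model: `U_∞ ≤ ker ρ ⊓ ker baseAct`, the lifts being the pairs
`(1, a)` of abc-iut-w4-d040's ArithTotalEstrangementOpenKernelObstruction.lean) together with closedness of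
the images `aug (ker levelAct j)` (open subgroups at the outer model, Def 5.1 (i)(c)).

* `iInter_mul_coe_eq_of_isCompact_of_le` — `⋂ᵢ W·Nᵢ = W` for a compact subgroup `W` and a directed family
  of open subgroups `Nᵢ` whose intersection lies in `W` (abc-iut-L3-t11's `iInter_mul_coe_eq_of_isCompact`
  had `⋂ Nᵢ = 1`);
* `CompactOrbit.forall_apply_eq_iff_mem_map_of_ker_of_le` — abc-iut-w4-d059's `Q`-stabiliser dictionary
  with `⋂ Kⱼ = 1` weakened to `⋂ Kⱼ ≤ ιQ(V)`;
* `map_aug_le_conj_of_levelDict_modKernel` — `map_aug_le_conj_of_levelDict′` VERBATIM (statement and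
  proof: abc-iut-w4-d059's text, the `Q`-package of abc-iut-w4-d029, the final push
  `map_aug_le_conj_of_stabilizer`) with `hcof` replaced by `hUclosed` + `hU`; the new step `hKV` shows
  `⋂ⱼ ker qAct j ≤ ιQ(Π_{v₀})` by density, continuity of `augQ`, closedness of the images and the
  faithfulness clause of the `Q`-package.

No definition, no new named fact; nothing here takes a side on [IUTchIII] Cor. 3.12; typed ≠ proved for
the residual binders.
-/

namespace Literature.AnabelianGeometry.SemiGraphs

open CategoryTheory Topology
open scoped Pointwise

universe v u w

/-! ### `⋂ᵢ W·Nᵢ = W` when the `Nᵢ` shrink INTO the compact subgroup `W` -/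

/-- **`⋂ᵢ W·Nᵢ = W`** for a compact subgroup `W` and a downward-directed family of open subgroups `Nᵢ`
with `⋂ᵢ Nᵢ ≤ W` (abc-iut-L3-t11's `iInter_mul_coe_eq_of_isCompact` is the case `⋂ᵢ Nᵢ = 1`): if
`g ∈ W·Nᵢ` for every `i`, the closed sets `W ∩ g·Nᵢ` of the compact `W` are directed and nonempty, so they
share a point `k`, and `k⁻¹g ∈ ⋂ Nᵢ ≤ W`. [cite: MochizukiSemiAnbd2006, Thm 3.7 (iii) p.41] -/
theorem iInter_mul_coe_eq_of_isCompact_of_le {G : Type u} [Group G] [TopologicalSpace G]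
    [IsTopologicalGroup G] [T2Space G] {ι : Type v} [Nonempty ι] (N : ι → Subgroup G)
    (hopen : ∀ i, IsOpen (N i : Set G)) (hdir : ∀ i j, ∃ k, N k ≤ N i ∧ N k ≤ N j)
    (W : Subgroup G) (hle : ∀ g : G, (∀ i, g ∈ N i) → g ∈ W) (hW : IsCompact (W : Set G)) :
    ⋂ i, (W : Set G) * (N i : Set G) = W := by
  apply Set.Subset.antisymm
  · intro g hg
    rw [Set.mem_iInter] at hg
    -- the closed sets `F i = W ∩ g·N_i`
    let F : ι → Set G := fun i => (W : Set G) ∩ (fun n : G => g * n) '' (N i : Set G)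
    have hFclosed : ∀ i, IsClosed (F i) := by
      intro i
      refine hW.isClosed.inter ?_
      have : (fun n : G => g * n) '' (N i : Set G) = (fun y : G => g⁻¹ * y) ⁻¹' (N i : Set G) := by
        ext y; constructor
        · rintro ⟨n, hn, rfl⟩; simpa using hn
        · intro hy; exact ⟨g⁻¹ * y, hy, by simp⟩
      rw [this]
      exact ((N i).isClosed_of_isOpen (hopen i)).preimage (continuous_const.mul continuous_id)
    have hFne : ∀ i, (F i).Nonempty := by
      intro i
      obtain ⟨k, hk, n, hn, hkn⟩ := Set.mem_mul.mp (hg i)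
      refine ⟨k, hk, n⁻¹, (N i).inv_mem hn, ?_⟩
      show g * n⁻¹ = k
      rw [← hkn, mul_inv_cancel_right]
    have hFdir : Directed (· ⊇ ·) F := by
      intro i j
      obtain ⟨k, hki, hkj⟩ := hdir i j
      refine ⟨k, ?_, ?_⟩
      · rintro y ⟨hyK, n, hn, rfl⟩; exact ⟨hyK, n, hki hn, rfl⟩
      · rintro y ⟨hyK, n, hn, rfl⟩; exact ⟨hyK, n, hkj hn, rfl⟩
    have hFsub : ∀ i, F i ⊆ (W : Set G) := fun i => Set.inter_subset_left
    -- a common point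
    obtain ⟨k, hk⟩ := IsCompact.nonempty_iInter_of_directed_nonempty_isCompact_isClosed F hFdir hFne
      (fun i => hW.of_isClosed_subset (hFclosed i) (hFsub i)) hFclosed
    rw [Set.mem_iInter] at hk
    have hkW : k ∈ W := (hk (Classical.arbitrary ι)).1
    have hgk : g⁻¹ * k ∈ W := by
      apply hle
      intro i
      obtain ⟨-, n, hn, hnk⟩ := hk i
      rw [← hnk, ← mul_assoc, inv_mul_cancel, one_mul]
      exact hn
    have : g = k * (g⁻¹ * k)⁻¹ := by group
    rw [this]
    exact W.mul_mem hkW (W.inv_mem hgk)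
  · intro k hk
    rw [Set.mem_iInter]
    intro i
    exact Set.mem_mul.mpr ⟨k, hk, 1, (N i).one_mem, mul_one k⟩

namespace CompactOrbit

/-- **The stabiliser in the completion from a levelwise dictionary, the joint kernel absorbed into `V`**
(abc-iut-w4-d059's `forall_apply_eq_iff_mem_map_of_ker` with `⋂ Kⱼ = 1` weakened to `⋂ Kⱼ ≤ ιQ(V)`):
`K_j ≤ ker φ_j` open, antitone; every `e ∈ E` fixing `s_j` is `v · k` with `v ∈ V`, `ιQ k ∈ K_j`; `V`
fixes `s`; then the `Q`-stabiliser of `s` is `ιQ(V)` (`ιQ(V)` compact, `ιQ` dense).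
[cite: MochizukiSemiAnbd2006, Thm 3.7 (iii) p.41] -/
theorem forall_apply_eq_iff_mem_map_of_ker_of_le {Q : Type u} [Group Q] [TopologicalSpace Q]
    [IsTopologicalGroup Q] [T2Space Q] {E : Type*} [Group E] (ιQ : E →* Q) (hdense : DenseRange ιQ)
    {J : Type v} [Preorder J] [IsDirectedOrder J] [Nonempty J]
    {X : J → Type w} (φ : ∀ j, Q →* Function.End (X j)) (K : J → Subgroup Q)
    (hKφ : ∀ j, K j ≤ (φ j).ker) (hK : ∀ j, IsOpen (K j : Set Q))
    (hanti : ∀ ⦃i j : J⦄, i ≤ j → K j ≤ K i)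
    (V : Subgroup E) (hbot : ∀ q : Q, (∀ j, q ∈ K j) → q ∈ V.map ιQ)
    (hVc : IsCompact ((V.map ιQ : Subgroup Q) : Set Q)) (s : ∀ j, X j)
    (hE : ∀ (j : J) (e : E), φ j (ιQ e) (s j) = s j → ∃ v ∈ V, ιQ (v⁻¹ * e) ∈ K j)
    (hV : ∀ v ∈ V, ∀ j, φ j (ιQ v) (s j) = s j) (q : Q) :
    (∀ j, φ j q (s j) = s j) ↔ q ∈ V.map ιQ := by
  constructor
  · intro hq
    have hmem : ∀ j, q ∈ ((V.map ιQ : Subgroup Q) : Set Q) * (K j : Set Q) := by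
      intro j
      have hopen : IsOpen {y : Q | q⁻¹ * y ∈ K j} := (hK j).preimage (continuous_const.mul continuous_id)
      obtain ⟨e, he⟩ := hdense.exists_mem_open hopen
        ⟨q, show q⁻¹ * q ∈ K j by rw [inv_mul_cancel]; exact (K j).one_mem⟩
      have hn : φ j (q⁻¹ * ιQ e) = 1 := hKφ j he
      have hfix : φ j (ιQ e) (s j) = s j := by
        have h1 : ιQ e = q * (q⁻¹ * ιQ e) := (mul_inv_cancel_left q (ιQ e)).symm
        rw [h1, map_mul, hn, mul_one, hq j]
      obtain ⟨v, hv, hve⟩ := hE j e hfix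
      refine Set.mem_mul.mpr ⟨ιQ v, ⟨v, hv, rfl⟩, ιQ (v⁻¹ * e) * (q⁻¹ * ιQ e)⁻¹,
        (K j).mul_mem hve ((K j).inv_mem he), ?_⟩
      rw [map_mul, map_inv]
      group
    have hdir : ∀ i j : J, ∃ k, K k ≤ K i ∧ K k ≤ K j := by
      intro i j
      obtain ⟨k, hik, hjk⟩ := exists_ge_ge i j
      exact ⟨k, hanti hik, hanti hjk⟩
    have := iInter_mul_coe_eq_of_isCompact_of_le K hK hdir (V.map ιQ) hbot hVc
    have hq' : q ∈ ⋂ j, ((V.map ιQ : Subgroup Q) : Set Q) * (K j : Set Q) := Set.mem_iInter.mpr hmem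
    rw [this] at hq'
    exact hq'
  · rintro ⟨v, hv, rfl⟩
    exact hV v hv

end CompactOrbit

section LevelDict

variable {E : Type u} [Group E] [TopologicalSpace E] [IsTopologicalGroup E]
  {PA : Type u} [Group PA] [TopologicalSpace PA] [IsTopologicalGroup PA] [CompactSpace PA] [T2Space PA]
  {J : Type v} [Preorder J] [IsDirectedOrder J]
  (G : J → SemiGraph.{u}) [∀ j, Finite (G j).Vertex] [∀ j, Finite (G j).Branch]
  (levelAct : ∀ j, E →* Aut (G j)) (gf : ∀ ⦃i j : J⦄, i ≤ j → (G j ⟶ G i))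

/-- **The (AI4″) branch-pair conclusion WITHOUT arithmetic cofinality** (abc-iut-w4-d059's
`map_aug_le_conj_of_levelDict′`, p433546, VERBATIM except that the binder `hcof` is replaced by
`hUclosed` — the images `aug (ker levelAct j)` are closed — and `hU` — every element of
`U_∞ := ⋂ⱼ aug (ker levelAct j)` is `aug z` for some `z ∈ Π_{v₀}` acting trivially at every level).  The
conclusion is the field text `ArithLevelDataCpt.stabBranchPairAug`.
[cite: MochizukiSemiAnbd2006, Thm 5.4 (i) p.66] -/
theorem map_aug_le_conj_of_levelDict_modKernel (aug : E →* PA) (haugc : Continuous aug)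
    (hker : ∀ j, IsOpen ((levelAct j).ker : Set E))
    (hanti : ∀ ⦃i j : J⦄, i ≤ j → (levelAct j).ker ≤ (levelAct i).ker)
    (hgfe : ∀ ⦃i j : J⦄ (h : i ≤ j) (e : E), (levelAct j e).hom ≫ gf h = gf h ≫ (levelAct i e).hom)
    {Base : SemiGraph.{u}} (proj : ∀ j, G j ⟶ Base)
    (hprojTrans : ∀ ⦃i j : J⦄ (h : i ≤ j), gf h ≫ proj i = proj j)
    (v₀ : Base.Vertex) (ω : ∀ j, (G j).Vertex) (hωv : ∀ j, (proj j).vertexMap (ω j) = v₀)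
    (hω : ∀ ⦃i j : J⦄ (h : i ≤ j), (gf h).vertexMap (ω j) = ω i)
    (κs : Base.Branch → ∀ j, (G j).Branch)
    (hκs : ∀ (b₀ : Base.Branch), Base.abuts b₀ = some v₀ →
      (∀ j, (G j).abuts (κs b₀ j) = some (ω j) ∧ (proj j).branchMap (κs b₀ j) = b₀) ∧
        ∀ ⦃i j : J⦄ (h : i ≤ j), (gf h).branchMap (κs b₀ j) = κs b₀ i)
    (htrans₁ : ∀ (j : J) (x : (G j).Vertex) (γ : (G j).Branch) (b₀ : Base.Branch),
      (proj j).vertexMap x = v₀ → (G j).abuts γ = some x → (proj j).branchMap γ = b₀ →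
      ∃ e : E, (levelAct j e).hom.vertexMap (ω j) = x ∧ (levelAct j e).hom.branchMap (κs b₀ j) = γ)
    (htrans₂ : ∀ (j : J) (γ : (G j).Branch) (b₀ : Base.Branch),
      (G j).abuts γ = some (ω j) → (proj j).branchMap γ = b₀ →
      ∃ e : E, (∀ i, (levelAct i e).hom.vertexMap (ω i) = ω i) ∧
        (levelAct j e).hom.branchMap (κs b₀ j) = γ)
    (j₀ : J) (w : ∀ i : {i : J // j₀ ≤ i}, (G i.1).Vertex) (β β' : ∀ i : {i : J // j₀ ≤ i}, (G i.1).Branch)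
    (hpair : ∀ i, β i ≠ β' i ∧ (G i.1).abuts (β i) = some (w i) ∧ (G i.1).abuts (β' i) = some (w i))
    (hcompat : ∀ ⦃i i' : {i : J // j₀ ≤ i}⦄ (h : i.1 ≤ i'.1), (gf h).vertexMap (w i') = w i ∧
      (gf h).branchMap (β i') = β i ∧ (gf h).branchMap (β' i') = β' i)
    (hbase : ∀ i : {i : J // j₀ ≤ i}, (proj i.1).vertexMap (w i) = v₀)
    (D : DecompositionData E Base.Vertex Base.Branch) (hDabut : ∀ b₀, D.abut b₀ = Base.abuts b₀)
    (hVc : IsCompact ((D.vertGp v₀ : Subgroup E) : Set E))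
    (hωE : ∀ (j : J) (e : E), (levelAct j e).hom.vertexMap (ω j) = ω j →
      ∃ v ∈ D.vertGp v₀, v⁻¹ * e ∈ (levelAct j).ker)
    (hωV : ∀ v ∈ D.vertGp v₀, ∀ j, (levelAct j v).hom.vertexMap (ω j) = ω j)
    (hκE' : ∀ (b₀ : Base.Branch), Base.abuts b₀ = some v₀ → ∀ v ∈ D.vertGp v₀,
      (∀ j, (levelAct j v).hom.branchMap (κs b₀ j) = κs b₀ j) → v ∈ D.brGp b₀)
    (hκV : ∀ (b₀ : Base.Branch), Base.abuts b₀ = some v₀ → ∀ v ∈ D.brGp b₀, ∀ j,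
      (levelAct j v).hom.vertexMap (ω j) = ω j ∧ (levelAct j v).hom.branchMap (κs b₀ j) = κs b₀ j)
    (hUclosed : ∀ j, IsClosed ((((levelAct j).ker).map aug : Subgroup PA) : Set PA))
    (hU : ∀ a : PA, (∀ j, a ∈ ((levelAct j).ker).map aug) →
      ∃ z ∈ D.vertGp v₀, aug z = a ∧ ∀ j, levelAct j z = 1)
    (hfaith : ∀ v ∈ D.vertGp v₀, (∀ j, levelAct j v = 1) → aug v = 1 → v = 1)
    (C : Subgroup E)
    (hC : ∀ (i : {i : J // j₀ ≤ i}) (e : E), e ∈ C → (levelAct i.1 e).hom.vertexMap (w i) = w i ∧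
      (levelAct i.1 e).hom.branchMap (β i) = β i ∧ (levelAct i.1 e).hom.branchMap (β' i) = β' i) :
    ∃ (v : Base.Vertex) (b b' : Base.Branch) (a : PA) (h : E), D.abut b = some v ∧ D.abut b' = some v ∧
      h ∈ D.vertGp v ∧ (b' ≠ b ∨ h ∉ D.brGp b) ∧
      C.map aug ≤ conjSubgroup a ((D.brGp b ⊓ conjSubgroup h (D.brGp b')).map aug) := by
  classical
  haveI : Nonempty J := ⟨j₀⟩
  -- the compact completion of the level tower (abc-iut-w4-d029)
  obtain ⟨Q, _, _, _, _, _, ιQ, qAct, augQ, hdense, hqker, hqAct, haugQ, hιker, hqfaith⟩ :=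
    exists_compactCompletion_faithful aug haugc G levelAct hker
  -- density transfers
  have hgfeQ : ∀ ⦃i j : J⦄ (h : i ≤ j) (q : Q), (qAct j q).hom ≫ gf h = gf h ≫ (qAct i q).hom :=
    fun i j h q => qAct_levelTrans_of_denseRange ιQ hdense G levelAct qAct hqker hqAct gf hgfe h q
  have hantiQ : ∀ ⦃i j : J⦄, i ≤ j → (qAct j).ker ≤ (qAct i).ker :=
    fun i j h => ker_qAct_le_of_denseRange ιQ hdense G levelAct qAct hqker hqAct (hanti h)
  -- WITHOUT `hcof`: the joint kernel `⋂ⱼ ker qAct j` of the completion lies in `ιQ(Π_{v₀})` — its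
  -- `Π_A`-coordinates are limits of `aug`-images of the level kernels (density, open kernels, `augQ`
  -- continuous), i.e. lie in `U_∞ := ⋂ⱼ aug (ker levelAct j)` (closed images), and `hU` realises them by
  -- elements of `Π_{v₀}` acting trivially at every level; faithfulness of `Q` identifies the two.
  have hKV : ∀ q : Q, (∀ j, q ∈ (qAct j).ker) → q ∈ (D.vertGp v₀).map ιQ.toMonoidHom := by
    intro q hq
    have hmemU : ∀ j, augQ q ∈ ((levelAct j).ker).map aug := by
      intro j
      -- `augQ q` is in the closure of `aug (ker levelAct j)`
      have hcl : augQ q ∈ closure ((((levelAct j).ker).map aug : Subgroup PA) : Set PA) := by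
        rw [mem_closure_iff]
        intro W hW hqW
        have hopen : IsOpen {y : Q | y ∈ (qAct j).ker ∧ augQ y ∈ W} :=
          (hqker j).inter (hW.preimage augQ.continuous)
        obtain ⟨e, he⟩ := hdense.exists_mem_open hopen ⟨q, hq j, hqW⟩
        obtain ⟨he1, he2⟩ := he
        refine ⟨aug e, ?_, ?_⟩
        · rw [← haugQ]; exact he2
        · refine ⟨e, ?_, rfl⟩
          rw [SetLike.mem_coe, MonoidHom.mem_ker, ← hqAct]
          exact (MonoidHom.mem_ker).mp he1
      rwa [(hUclosed j).closure_eq] at hcl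
    obtain ⟨z, hzV, hza, hz1⟩ := hU (augQ q) hmemU
    have hzq : q = ιQ z := by
      have h1 : ∀ j, qAct j (q⁻¹ * ιQ z) = 1 := fun j => by
        rw [map_mul, map_inv, hqAct, hz1 j, mul_one, inv_eq_one]
        exact (MonoidHom.mem_ker).mp (hq j)
      have h2 : augQ (q⁻¹ * ιQ z) = 1 := by
        rw [map_mul, map_inv, haugQ, hza, inv_mul_cancel]
      have := hqfaith (q⁻¹ * ιQ z) h1 h2
      rw [inv_mul_eq_one] at this
      exact this
    exact ⟨z, hzV, hzq.symm⟩
  -- the vertex action as monoid homomorphisms with kernels above `ker qAct`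
  let φV : ∀ j, Q →* Function.End (G j).Vertex := fun j =>
    { toFun := fun q => fun z : (G j).Vertex => (qAct j q).hom.vertexMap z
      map_one' := by funext z; show (qAct j 1).hom.vertexMap z = z; rw [map_one]; rfl
      map_mul' := fun a b => by
        funext z; show (qAct j (a * b)).hom.vertexMap z = _; rw [map_mul]; rfl }
  have hφV : ∀ j, (qAct j).ker ≤ (φV j).ker := fun j q hq => by
    rw [MonoidHom.mem_ker] at hq ⊢
    funext z; show (qAct j q).hom.vertexMap z = z; rw [hq]; rfl
  -- compact images
  have himV : IsCompact (((D.vertGp v₀).map ιQ.toMonoidHom : Subgroup Q) : Set Q) := by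
    rw [Subgroup.coe_map]; exact hVc.image ιQ.continuous
  -- the Q-dictionaries from the E-dictionaries
  have hω_dict : ∀ q : Q, (∀ j, (qAct j q).hom.vertexMap (ω j) = ω j) ↔
      q ∈ (D.vertGp v₀).map ιQ.toMonoidHom := fun q =>
    CompactOrbit.forall_apply_eq_iff_mem_map_of_ker_of_le ιQ.toMonoidHom hdense φV (fun j => (qAct j).ker)
      hφV hqker hantiQ (D.vertGp v₀) hKV himV ω
      (fun j e he => by
        obtain ⟨v, hv, hve⟩ := hωE j e (by
          have : (qAct j (ιQ e)).hom.vertexMap (ω j) = ω j := he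
          rwa [hqAct] at this)
        refine ⟨v, hv, ?_⟩
        show qAct j (ιQ (v⁻¹ * e)) = 1
        rw [hqAct]; exact hve)
      (fun v hv j => by
        show (qAct j (ιQ v)).hom.vertexMap (ω j) = ω j
        rw [hqAct]; exact hωV v hv j) q
  have hκ_dict : ∀ b₀ : Base.Branch, Base.abuts b₀ = some v₀ → ∀ q : Q,
      (∀ j, (qAct j q).hom.vertexMap (ω j) = ω j ∧ (qAct j q).hom.branchMap (κs b₀ j) = κs b₀ j) ↔
        q ∈ (D.brGp b₀).map ιQ.toMonoidHom := fun b₀ hb₀ q => by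
    constructor
    · intro h
      obtain ⟨v, hv, hvq⟩ := (hω_dict q).mp fun j => (h j).1
      refine ⟨v, hκE' b₀ hb₀ v hv fun j => ?_, hvq⟩
      have := (h j).2
      rw [← hvq] at this
      change (qAct j (ιQ v)).hom.branchMap (κs b₀ j) = κs b₀ j at this
      rwa [hqAct] at this
    · rintro ⟨v, hv, rfl⟩ j
      change (qAct j (ιQ v)).hom.vertexMap (ω j) = ω j ∧ (qAct j (ιQ v)).hom.branchMap (κs b₀ j) = κs b₀ j
      rw [hqAct]; exact hκV b₀ hb₀ v hv j
  -- injectivity of `ιQ` on `Π_{v₀}` from the kernel computation and faithfulness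
  have hinj : Set.InjOn ιQ.toMonoidHom (D.vertGp v₀) := by
    intro a ha b hb hab
    have hmem : a⁻¹ * b ∈ ιQ.toMonoidHom.ker := by
      rw [MonoidHom.mem_ker, map_mul, map_inv]
      exact inv_mul_eq_one.mpr hab
    rw [hιker] at hmem
    obtain ⟨h1, h2⟩ := Subgroup.mem_inf.mp hmem
    have hab' : a⁻¹ * b = 1 := hfaith (a⁻¹ * b) ((D.vertGp v₀).mul_mem ((D.vertGp v₀).inv_mem ha) hb)
      (fun j => (MonoidHom.mem_ker).mp (Subgroup.mem_iInf.mp h1 j)) ((MonoidHom.mem_ker).mp h2)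
    exact inv_mul_eq_one.mp hab'
  -- transitivity at the `Q`-level
  have htrans₁Q : ∀ (j : J) (x : (G j).Vertex) (γ : (G j).Branch) (b₀ : Base.Branch),
      (proj j).vertexMap x = v₀ → (G j).abuts γ = some x → (proj j).branchMap γ = b₀ →
      ∃ q : Q, (qAct j q).hom.vertexMap (ω j) = x ∧ (qAct j q).hom.branchMap (κs b₀ j) = γ := by
    intro j x γ b₀ hx hγ hb
    obtain ⟨e, he⟩ := htrans₁ j x γ b₀ hx hγ hb
    exact ⟨ιQ e, by rw [hqAct]; exact he⟩
  have htrans₂Q : ∀ (j : J) (γ : (G j).Branch) (b₀ : Base.Branch),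
      (G j).abuts γ = some (ω j) → (proj j).branchMap γ = b₀ →
      ∃ a : Q, (∀ i, (qAct i a).hom.vertexMap (ω i) = ω i) ∧ (qAct j a).hom.branchMap (κs b₀ j) = γ := by
    intro j γ b₀ hγ hb
    obtain ⟨e, he₁, he₂⟩ := htrans₂ j γ b₀ hγ hb
    exact ⟨ιQ e, fun i => by rw [hqAct]; exact he₁ i, by rw [hqAct]; exact he₂⟩
  -- apply the `Q`-level theorem
  exact map_aug_le_conj_of_stabilizer G qAct gf hqker hgfeQ proj hprojTrans v₀ ω hωv hω κs hκs htrans₁Q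
    htrans₂Q j₀ w β β' hpair hcompat hbase ιQ.toMonoidHom aug augQ.toMonoidHom haugQ D hDabut hω_dict
    hκ_dict hinj C (fun i e he => by
      show (qAct i.1 (ιQ e)).hom.vertexMap (w i) = w i ∧ (qAct i.1 (ιQ e)).hom.branchMap (β i) = β i ∧
        (qAct i.1 (ιQ e)).hom.branchMap (β' i) = β' i
      rw [hqAct]; exact hC i e he)

end LevelDict

end Literature.AnabelianGeometry.SemiGraphs
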